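import Literature.NumberTheory.Sieve.IwaniecAlmostPrimes
import Literature.NumberTheory.LFunctions.KloostermanWeil
import Literature.NumberTheory.LFunctions.KloostermanWeilFromPrime
import Literature.NumberTheory.Sieve.VinogradovExpSumTools
import Literature.NumberTheory.Sieve.DivisorBound
import HarnessLib

/-!
# Iwaniec (1978), Lemma 6: Hooley's bound for incomplete Kloosterman sums, from Weil's bound — PROVED

H. Iwaniec, *Almost-primes represented by quadratic polynomials*, Invent. Math. **47** (1978)
171–188, Lemma 6 (p. 178) [cite: IwaniecInventiones1978, Lemma 6] = C. Hooley, Acta Math. **117**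
(1967), Lemma 3: for integers `h`, `s ≥ 1`, `0 < r₂ − r₁ < 2s`, `λ` and a modulus `Λ ≥ 1`,
`∑_{r₁ < r < r₂, (r,s)=1, r ≡ λ (mod Λ)} e(h r̄ / s) ≪_ε s^{1/2+ε} (h, s)^{1/2}`.
This is the named fact `lemma6_hooley` of `IwaniecAlmostPrimes.lean`, the only external input of
Iwaniec's Lemma 4 / Proposition 1 besides elementary counting.  This file PROVES

* `lemma6_hooley_of_weil : Literature.NumberTheory.LFunctions.weil_kloosterman_bound → lemma6_hooley`,
* `lemma6_hooley_of_weil_prime : Literature.NumberTheory.LFunctions.weil_kloosterman_bound_prime →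
  lemma6_hooley` (appended; via `weil_kloosterman_bound_of_prime`),

reducing it to the tree's named Weil bound `|S(m, n; c)| ≤ (m, n, c)^{1/2} c^{1/2} τ(c)`
(`KloostermanWeil.lean`, [cite: Iwaniec2002, §2.5 (2.25)]).

Proof (the standard completion argument).  Detect `r ≡ λ (mod Λ)` by the additive characters
modulo `Λ`: `[r ≡ λ] = Λ⁻¹ ∑_{b mod Λ} e_Λ(b(r − λ))`; the weight
`G(r) = [(r, s) = 1] e_s(h r̄)` is `s`-periodic with finite Fourier transform
`Ĝ(a) = ∑_{u mod s} G(u) e_s(−au) = S(−a, h; s)` (a complete Kloosterman sum, a Ramanujan sum for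
`a = 0`), so `G(r) = s⁻¹ ∑_{a mod s} Ĝ(a) e_s(ar)` and the sum over the `< 2s` consecutive integers
`r` becomes `Λ⁻¹ ∑_b e_Λ(−bλ) s⁻¹ ∑_a Ĝ(a) ∑_r e(r(a/s + b/Λ))`.  By Weil's bound
`|Ĝ(a)| ≤ τ(s) s^{1/2} (a, h, s)^{1/2} ≤ τ(s) s^{1/2} (h, s)^{1/2}` for every `a`; the geometric
sums are `≤ min(2s, 1/(2‖a/s + b/Λ‖))` and the points `a/s + b/Λ`, `a mod s`, are `1/s`-spaced,
so `∑_a min(…) ≤ 4s + s(1 + log s)` (`Vinogradov.sum_geomBound_le_of_separated`).  Altogether the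
sum is at most `τ(s)(5 + log s) s^{1/2} (h, s)^{1/2} ≤ C_τ(ε/2)(5 + 2/ε) s^{1/2+ε} (h, s)^{1/2}`
by the divisor bound `τ(s) ≤ C s^{ε/2}` (`exists_card_divisors_le_mul_rpow`) and
`log s ≤ (2/ε) s^{ε/2}`.  (No hypothesis on `Λ` beyond `Λ ≥ 1` is needed, and the bound is uniform
in `λ`, `Λ`, as printed.)

## References

* H. Iwaniec, Invent. Math. 47 (1978) 171–188, Lemma 6 (`IwaniecInventiones1978`).
* C. Hooley, *On the greatest prime factor of a quadratic polynomial*, Acta Math. 117 (1967)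
  281–299, Lemma 3.
* H. Iwaniec, *Spectral Methods of Automorphic Forms*, 2nd ed. (2002), (2.25) (`Iwaniec2002`).
-/

noncomputable section

open Finset
open scoped FourierTransform

namespace Literature.NumberTheory.Sieve.Iwaniec1978

open Literature.NumberTheory.LFunctions (kloostermanSum weil_kloosterman_bound)
open Literature.NumberTheory.Sieve.Vinogradov (distInt geomBound distInt_nonneg geomBound_nonneg
  geomBound_le sum_geomBound_le_of_separated norm_sum_Icc_fourierChar_le_geomBound)

/-! ### Additive characters and the summand `e(h r̄ / s)` -/

/-- The summand of Lemma 6 is the standard additive character at `h r̄`: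
`e(h · r̄ / s) = e_s(h r⁻¹)` with `r̄ = ((r mod s)⁻¹).val`. [folklore] -/
theorem hooley_term_eq_stdAddChar {s : ℕ} [NeZero s] (h r : ℤ) :
    Complex.exp (2 * Real.pi * Complex.I *
        ((h : ℂ) * ((((r : ZMod s)⁻¹).val : ℕ) : ℂ) / (s : ℂ))) =
      (ZMod.stdAddChar ((h : ZMod s) * (r : ZMod s)⁻¹) : ℂ) := by
  have hc : (h : ZMod s) * (r : ZMod s)⁻¹ = (((h * (((r : ZMod s)⁻¹).val : ℕ) : ℤ)) : ZMod s) := by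
    push_cast
    rw [ZMod.natCast_zmod_val]
  rw [hc, ZMod.stdAddChar_coe]
  congr 1
  push_cast
  ring

/-- `(r, s) = 1` iff `r` is a unit modulo `s`. [folklore] -/
theorem hooley_gcd_eq_one_iff_isUnit {s : ℕ} (r : ℤ) :
    Int.gcd r s = 1 ↔ IsUnit (r : ZMod s) := by
  rw [ZMod.coe_int_isUnit_iff_isCoprime, Int.isCoprime_iff_gcd_eq_one, Int.gcd_comm]

/-- `e_s(a r) e_Λ(b r) = e(r (a/s + b/Λ))` for an integer `r` (with `a`, `b` read through their
least nonnegative residues). [folklore] -/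
theorem hooley_stdAddChar_mul_stdAddChar {s Λ : ℕ} [NeZero s] [NeZero Λ] (a : ZMod s)
    (b : ZMod Λ) (r : ℤ) :
    (ZMod.stdAddChar (a * (r : ZMod s)) : ℂ) * (ZMod.stdAddChar (b * (r : ZMod Λ)) : ℂ) =
      (𝐞 ((r : ℝ) * ((a.val : ℝ) / s + (b.val : ℝ) / Λ)) : ℂ) := by
  have ha : a * (r : ZMod s) = (((a.val : ℤ) * r : ℤ) : ZMod s) := by
    push_cast; rw [ZMod.natCast_zmod_val]
  have hb : b * (r : ZMod Λ) = (((b.val : ℤ) * r : ℤ) : ZMod Λ) := by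
    push_cast; rw [ZMod.natCast_zmod_val]
  rw [ha, hb, ZMod.stdAddChar_coe, ZMod.stdAddChar_coe, ← Complex.exp_add, Real.fourierChar_apply]
  congr 1
  have hs : (s : ℂ) ≠ 0 := Nat.cast_ne_zero.mpr (NeZero.ne s)
  have hΛ : (Λ : ℂ) ≠ 0 := Nat.cast_ne_zero.mpr (NeZero.ne Λ)
  push_cast
  field_simp

/-- Detecting a residue class by additive characters:
`∑_{b mod Λ} e_Λ(b (r − λ)) = Λ [r ≡ λ (mod Λ)]`. [folklore] -/
theorem hooley_sum_stdAddChar_detect {Λ : ℕ} [NeZero Λ] (r lam : ℤ) :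
    ∑ b : ZMod Λ, (ZMod.stdAddChar (b * ((r - lam : ℤ) : ZMod Λ)) : ℂ) =
      if r ≡ lam [ZMOD Λ] then (Λ : ℂ) else 0 := by
  rw [AddChar.sum_mulShift _ (ZMod.isPrimitive_stdAddChar Λ), ZMod.card]
  have hiff : ((r - lam : ℤ) : ZMod Λ) = 0 ↔ r ≡ lam [ZMOD Λ] := by
    rw [ZMod.intCast_zmod_eq_zero_iff_dvd, Int.modEq_comm, Int.modEq_iff_dvd]
  by_cases hmod : r ≡ lam [ZMOD Λ]
  · rw [if_pos (hiff.mpr hmod), if_pos hmod]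
  · rw [if_neg (fun h0 => hmod (hiff.mp h0)), if_neg hmod, Nat.cast_zero]

/-! ### Completion modulo `s`: finite Fourier inversion and the Kloosterman sums -/

/-- **Finite Fourier inversion on `ℤ/sℤ`:** with `Ĝ(a) = ∑_u G(u) e_s(−au)`,
`∑_a Ĝ(a) e_s(a v) = s · G(v)`. [folklore] -/
theorem hooley_fourier_inversion {s : ℕ} [NeZero s] (G : ZMod s → ℂ) (v : ZMod s) :
    ∑ a : ZMod s, (∑ u : ZMod s, G u * (ZMod.stdAddChar (-(a * u)) : ℂ)) *
        (ZMod.stdAddChar (a * v) : ℂ) = (s : ℂ) * G v := by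
  classical
  calc ∑ a : ZMod s, (∑ u : ZMod s, G u * (ZMod.stdAddChar (-(a * u)) : ℂ)) *
          (ZMod.stdAddChar (a * v) : ℂ)
      = ∑ u : ZMod s, G u * ∑ a : ZMod s, (ZMod.stdAddChar (a * (v - u)) : ℂ) := by
        simp_rw [Finset.sum_mul]
        rw [Finset.sum_comm]
        simp_rw [Finset.mul_sum]
        refine Finset.sum_congr rfl fun u _ => Finset.sum_congr rfl fun a _ => ?_
        rw [mul_assoc, ← AddChar.map_add_eq_mul, show -(a * u) + a * v = a * (v - u) by ring]
    _ = ∑ u : ZMod s, G u * (if v - u = 0 then (s : ℂ) else 0) := by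
        refine Finset.sum_congr rfl fun u _ => ?_
        rw [AddChar.sum_mulShift _ (ZMod.isPrimitive_stdAddChar s), ZMod.card, Nat.cast_ite,
          Nat.cast_zero]
    _ = (s : ℂ) * G v := by
        simp_rw [sub_eq_zero, mul_ite, mul_zero]
        rw [Finset.sum_ite_eq Finset.univ v (fun u => G u * (s : ℂ))]
        simp [mul_comm]

/-- **The finite Fourier transform of `G(u) = [u unit] e_s(h u⁻¹)` is a complete Kloosterman sum:**
`∑_u G(u) e_s(−au) = S(−a, h; s)` (`Literature.NumberTheory.LFunctions.kloostermanSum`). [folklore] -/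
theorem hooley_transform_eq_kloostermanSum {s : ℕ} [NeZero s] (hh a : ZMod s) :
    ∑ u : ZMod s, (if IsUnit u then (ZMod.stdAddChar (hh * u⁻¹) : ℂ) else 0) *
        (ZMod.stdAddChar (-(a * u)) : ℂ) = kloostermanSum s (-a) hh := by
  classical
  unfold kloostermanSum
  refine Finset.sum_congr rfl fun u _ => ?_
  split_ifs with hu
  · rw [← AddChar.map_add_eq_mul, show hh * u⁻¹ + -(a * u) = -a * u + hh * u⁻¹ by ring]
  · rw [zero_mul]

/-- **Weil's bound for the transform**: `|S(−a, h; s)| ≤ τ(s) s^{1/2} (h, s)^{1/2}` for every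
`a mod s` (for `a = 0` this is weaker than the Ramanujan-sum bound `(h, s)`), from
`weil_kloosterman_bound` and `(a, h, s) ∣ (h, s)`. [cite: Iwaniec2002, §2.5 (2.25)] -/
theorem hooley_norm_kloostermanSum_le (hW : weil_kloosterman_bound) {s : ℕ} [NeZero s]
    (a : ZMod s) (h : ℤ) :
    ‖kloostermanSum s (-a) (h : ZMod s)‖ ≤
      (Nat.divisors s).card * Real.sqrt s * Real.sqrt (Int.gcd h s) := by
  have hcast : (-a : ZMod s) = (((-(a.val : ℤ)) : ℤ) : ZMod s) := by
    push_cast; rw [ZMod.natCast_zmod_val]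
  have hWa := hW s (-(a.val : ℤ)) h
  rw [← hcast] at hWa
  refine hWa.trans ?_
  have hs0 : 0 < s := Nat.pos_of_ne_zero (NeZero.ne s)
  have hgcd : (Nat.gcd (Nat.gcd (-(a.val : ℤ)).natAbs h.natAbs) s : ℝ) ≤ (Int.gcd h s : ℝ) := by
    have hI : Int.gcd h s = Nat.gcd h.natAbs s := by
      rw [Int.gcd_eq_natAbs, Int.natAbs_natCast]
    have hdvd : Nat.gcd (Nat.gcd (-(a.val : ℤ)).natAbs h.natAbs) s ∣ Nat.gcd h.natAbs s :=
      Nat.gcd_dvd_gcd_of_dvd_left s (Nat.gcd_dvd_right _ _)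
    have hpos : 0 < Nat.gcd h.natAbs s := Nat.gcd_pos_of_pos_right _ hs0
    rw [hI]
    exact_mod_cast Nat.le_of_dvd hpos hdvd
  calc Real.sqrt (Nat.gcd (Nat.gcd (-(a.val : ℤ)).natAbs h.natAbs) s) * Real.sqrt s *
        (Nat.divisors s).card
      ≤ Real.sqrt (Int.gcd h s) * Real.sqrt s * (Nat.divisors s).card := by
        gcongr
    _ = (Nat.divisors s).card * Real.sqrt s * Real.sqrt (Int.gcd h s) := by ring

/-! ### Geometric sums over a run of consecutive integers and the spacing of `a/s + β` -/

/-- `|∑_{n < K} e((c + 1 + n) θ)| ≤ min(V, 1/(2‖θ‖))` for `K ≤ V` (a run of `K` consecutive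
integers starting at `c + 1`; Nathanson's Lemma 4.7 via `norm_sum_Icc_fourierChar_le_geomBound`).
[folklore] -/
theorem hooley_norm_sum_range_fourierChar_le (c : ℤ) {K : ℕ} {V : ℝ} (θ : ℝ) (hK : (K : ℝ) ≤ V) :
    ‖∑ n ∈ Finset.range K, (𝐞 (((c + 1 + (n : ℤ) : ℤ) : ℝ) * θ) : ℂ)‖ ≤ geomBound V θ := by
  have hterm : ∀ n : ℕ, (𝐞 (((c + 1 + (n : ℤ) : ℤ) : ℝ) * θ) : ℂ) =
      (𝐞 ((c : ℝ) * θ) : ℂ) * (𝐞 (((n + 1 : ℕ) : ℝ) * θ) : ℂ) := by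
    intro n
    rw [← Circle.coe_mul, ← AddChar.map_add_eq_mul]
    congr 2
    push_cast; ring
  simp_rw [hterm]
  rw [← Finset.mul_sum, norm_mul, Circle.norm_coe, one_mul]
  have hshift : ∑ n ∈ Finset.range K, (𝐞 (((n + 1 : ℕ) : ℝ) * θ) : ℂ) =
      ∑ m ∈ Finset.Icc 1 K, (𝐞 ((m : ℝ) * θ) : ℂ) := by
    rw [← Finset.Ico_add_one_right_eq_Icc, Finset.sum_Ico_eq_sum_range]
    refine Finset.sum_congr (by simp) fun n _ => ?_
    rw [add_comm]
  rw [hshift]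
  exact norm_sum_Icc_fourierChar_le_geomBound θ hK

/-- The points `a/s + β`, `0 ≤ a < s`, are `1/s`-separated modulo `1`. [folklore] -/
theorem hooley_separated {s : ℕ} (hs : 0 < s) (β : ℝ) :
    ∀ a ∈ Finset.range s, ∀ a' ∈ Finset.range s, a ≠ a' →
      1 / (s : ℝ) ≤ distInt (((a : ℝ) / s + β) - ((a' : ℝ) / s + β)) := by
  intro a ha a' ha' hne
  rw [Finset.mem_range] at ha ha'
  have hs0 : (0 : ℝ) < s := by exact_mod_cast hs
  set k : ℤ := (a : ℤ) - a' with hk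
  have hx : ((a : ℝ) / s + β) - ((a' : ℝ) / s + β) = (k : ℝ) / s := by
    rw [hk]; push_cast; ring
  rw [hx]
  -- `k/s - round(k/s) = j/s` with `j = k - s · round(k/s)` a nonzero integer
  set x : ℝ := (k : ℝ) / s with hxdef
  have hxj : x - round x = ((k - s * round x : ℤ) : ℝ) / s := by
    push_cast; rw [hxdef]; field_simp
  have hkabs : |k| < s := by
    rw [hk, abs_lt]; constructor <;> omega
  have hkne : k ≠ 0 := by rw [hk]; omega
  have hj0 : (k - s * round x : ℤ) ≠ 0 := by
    intro h0
    have hk_eq : k = s * round x := by linarith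
    rcases eq_or_ne (round x) 0 with hr | hr
    · rw [hr, mul_zero] at hk_eq; exact hkne hk_eq
    · have h1 : 1 ≤ |round x| := Int.one_le_abs hr
      have h2 : (s : ℤ) ≤ |k| := by
        rw [hk_eq, abs_mul, Nat.abs_cast]
        exact le_mul_of_one_le_right (by positivity) h1
      linarith
  unfold distInt
  rw [hxj, abs_div, abs_of_pos hs0]
  have : (1 : ℝ) ≤ |((k - s * round x : ℤ) : ℝ)| := by
    rw [← Int.cast_abs]; exact_mod_cast Int.one_le_abs hj0
  exact div_le_div_of_nonneg_right this hs0.le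

/-- `∑_{a mod s} min(V, 1/(2‖a/s + β‖)) ≤ 2V + s(1 + log s)`. [folklore] -/
theorem hooley_sum_geomBound_le {s : ℕ} (hs : 0 < s) (β : ℝ) {V : ℝ} (hV : 0 ≤ V) :
    ∑ a ∈ Finset.range s, geomBound V ((a : ℝ) / s + β) ≤ 2 * V + s * (1 + Real.log s) := by
  have hs0 : (0 : ℝ) < s := by exact_mod_cast hs
  have hδ : (0 : ℝ) < 1 / s := by positivity
  have hm : 1 / (2 * (1 / (s : ℝ))) ≤ (s : ℕ) := by
    rw [show 1 / (2 * (1 / (s : ℝ))) = s / 2 by field_simp]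
    linarith
  have h := sum_geomBound_le_of_separated (Finset.range s) (fun a : ℕ => (a : ℝ) / s + β) hδ hm
    (hooley_separated hs β) hV
  simpa using h

/-! ### Lemma 6 from Weil's bound -/

/-- `5 + log s ≤ (5 + 2/ε) s^{ε/2}` for `s ≥ 1`. [folklore] -/
theorem hooley_log_le {ε : ℝ} (hε : 0 < ε) {s : ℝ} (hs : 1 ≤ s) :
    5 + Real.log s ≤ (5 + 2 / ε) * s ^ (ε / 2) := by
  have h1 : 1 ≤ s ^ (ε / 2) := Real.one_le_rpow hs (by positivity)
  have h2 : Real.log s ≤ s ^ (ε / 2) / (ε / 2) := Real.log_le_rpow_div (by linarith) (by positivity)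
  have h3 : s ^ (ε / 2) / (ε / 2) = 2 / ε * s ^ (ε / 2) := by field_simp
  nlinarith

set_option maxHeartbeats 800000 in
/-- **Iwaniec 1978, Lemma 6 (= Hooley 1967, Lemma 3) from Weil's bound — PROVED:**
`weil_kloosterman_bound → lemma6_hooley`, with the constant `C(ε) = C_τ(ε/2) (5 + 2/ε)`, `C_τ` the
constant of the divisor bound `τ(n) ≤ C_τ n^{ε/2}`. [cite: IwaniecInventiones1978, Lemma 6] -/
theorem lemma6_hooley_of_weil (hW : weil_kloosterman_bound) : lemma6_hooley := by
  intro ε hε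
  obtain ⟨Cτ, hCτ1, hCτ⟩ := exists_card_divisors_le_mul_rpow (half_pos hε)
  refine ⟨Cτ * (5 + 2 / ε), fun s Λ h r₁ r₂ lam hs hΛ hr hlen => ?_⟩
  classical
  haveI : NeZero s := ⟨by omega⟩
  haveI : NeZero Λ := ⟨by omega⟩
  have hs0 : 0 < s := by omega
  have hs0' : (0 : ℝ) < s := by exact_mod_cast hs0
  have hs1' : (1 : ℝ) ≤ s := by exact_mod_cast hs
  -- notation
  set ψs : AddChar (ZMod s) ℂ := ZMod.stdAddChar with hψs
  set ψΛ : AddChar (ZMod Λ) ℂ := ZMod.stdAddChar with hψΛ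
  set hh : ZMod s := (h : ZMod s) with hhh
  set G : ZMod s → ℂ := fun u => if IsUnit u then (ψs (hh * u⁻¹) : ℂ) else 0 with hG
  set Gh : ZMod s → ℂ := fun a => ∑ u : ZMod s, G u * (ψs (-(a * u)) : ℂ) with hGh
  set B : ℝ := (Nat.divisors s).card * Real.sqrt s * Real.sqrt (Int.gcd h s) with hB
  have hB0 : 0 ≤ B := by positivity
  have hGnorm : ∀ u, ‖G u‖ ≤ 1 := by
    intro u
    simp only [hG]
    split_ifs
    · rw [hψs, ZMod.stdAddChar_apply, Circle.norm_coe]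
    · simp
  have hGh_le : ∀ a, ‖Gh a‖ ≤ B := by
    intro a
    have := hooley_norm_kloostermanSum_le hW a h
    rw [← hooley_transform_eq_kloostermanSum] at this
    exact this
  -- the run of consecutive integers `r₁ < r < r₂` as `r₁ + 1 + n`, `n < K`
  obtain ⟨K, hK⟩ : ∃ K : ℕ, (K : ℤ) = r₂ - r₁ - 1 := ⟨(r₂ - r₁ - 1).toNat, by omega⟩
  have hKV : (K : ℝ) ≤ 2 * s := by
    have : (K : ℤ) ≤ 2 * s := by omega
    exact_mod_cast this
  set rr : ℕ → ℤ := fun n => r₁ + 1 + (n : ℤ) with hrr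
  have hIoo : Finset.Ioo r₁ r₂ = (Finset.range K).map ⟨rr, fun a b hab => by
      simp only [hrr] at hab; exact_mod_cast (add_left_cancel hab)⟩ := by
    ext m
    simp only [Finset.mem_Ioo, Finset.mem_map, Finset.mem_range, Function.Embedding.coeFn_mk, hrr]
    constructor
    · rintro ⟨h1, h2⟩
      refine ⟨(m - r₁ - 1).toNat, ?_, ?_⟩ <;> omega
    · rintro ⟨n, hn, rfl⟩; omega
  -- Step 1: the summand through `G` and the detection of `r ≡ λ (Λ)`
  have hstep1 : ∀ r : ℤ,
      (if Int.gcd r s = 1 ∧ r ≡ lam [ZMOD Λ] then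
        Complex.exp (2 * Real.pi * Complex.I *
          ((h : ℂ) * ((((r : ZMod s)⁻¹).val : ℕ) : ℂ) / (s : ℂ))) else 0) =
      (Λ : ℂ)⁻¹ * (∑ b : ZMod Λ, (ψΛ (b * ((r - lam : ℤ) : ZMod Λ)) : ℂ)) * G (r : ZMod s) := by
    intro r
    rw [hψΛ, hooley_sum_stdAddChar_detect r lam]
    have hΛ0 : (Λ : ℂ) ≠ 0 := Nat.cast_ne_zero.mpr (by omega)
    by_cases hmod : r ≡ lam [ZMOD Λ]
    · rw [if_pos hmod, inv_mul_cancel₀ hΛ0, one_mul]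
      by_cases hg : Int.gcd r s = 1
      · rw [if_pos ⟨hg, hmod⟩, hooley_term_eq_stdAddChar]
        simp only [hG, hhh, hψs]
        rw [if_pos ((hooley_gcd_eq_one_iff_isUnit r).mp hg)]
      · rw [if_neg (fun h' => hg h'.1)]
        simp only [hG]
        rw [if_neg (fun hu => hg ((hooley_gcd_eq_one_iff_isUnit r).mpr hu))]
    · rw [if_neg (fun h' => hmod h'.2), if_neg hmod, mul_zero, zero_mul]
  -- Step 2: rewrite the sum as `Λ⁻¹ ∑_b e_Λ(−bλ) T_b` with `T_b = ∑_n e_Λ(b r_n) G(r_n)`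
  set T : ZMod Λ → ℂ := fun b => ∑ n ∈ Finset.range K, (ψΛ (b * (rr n : ZMod Λ)) : ℂ) * G (rr n)
    with hT
  have hS_eq : ∑ r ∈ (Finset.Ioo r₁ r₂).filter (fun r : ℤ => Int.gcd r s = 1 ∧ r ≡ lam [ZMOD Λ]),
      Complex.exp (2 * Real.pi * Complex.I *
        ((h : ℂ) * ((((r : ZMod s)⁻¹).val : ℕ) : ℂ) / (s : ℂ))) =
      (Λ : ℂ)⁻¹ * ∑ b : ZMod Λ, (ψΛ (-(b * (lam : ZMod Λ))) : ℂ) * T b := by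
    rw [Finset.sum_filter, hIoo, Finset.sum_map]
    simp only [Function.Embedding.coeFn_mk]
    simp_rw [hstep1, mul_assoc, ← Finset.mul_sum]
    congr 1
    simp_rw [Finset.sum_mul]
    rw [Finset.sum_comm]
    refine Finset.sum_congr rfl fun b _ => ?_
    rw [hT, Finset.mul_sum]
    refine Finset.sum_congr rfl fun n _ => ?_
    have hsplit : b * ((rr n - lam : ℤ) : ZMod Λ) = -(b * (lam : ZMod Λ)) + b * (rr n : ZMod Λ) := by
      push_cast; ring
    rw [hsplit, AddChar.map_add_eq_mul, mul_assoc]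
  -- Step 3: `T_b` through the completed sums, and its bound
  have hT_le : ∀ b : ZMod Λ, ‖T b‖ ≤ B * (5 + Real.log s) := by
    intro b
    -- `G(r) = s⁻¹ ∑_a Ĝ(a) e_s(a r)`
    have hGinv : ∀ r : ℤ, G (r : ZMod s) =
        (s : ℂ)⁻¹ * ∑ a : ZMod s, Gh a * (ψs (a * (r : ZMod s)) : ℂ) := by
      intro r
      have hinv := hooley_fourier_inversion G (r : ZMod s)
      have hs0c : (s : ℂ) ≠ 0 := Nat.cast_ne_zero.mpr (by omega)
      rw [hGh, hψs, hinv, ← mul_assoc, inv_mul_cancel₀ hs0c, one_mul]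
    have hT_eq : T b = (s : ℂ)⁻¹ * ∑ a : ZMod s, Gh a *
        ∑ n ∈ Finset.range K, (𝐞 (((rr n : ℤ) : ℝ) * ((a.val : ℝ) / s + (b.val : ℝ) / Λ)) : ℂ) := by
      rw [hT]
      simp_rw [hGinv]
      simp_rw [Finset.mul_sum]
      rw [Finset.sum_comm]
      refine Finset.sum_congr rfl fun a _ => Finset.sum_congr rfl fun n _ => ?_
      rw [← hooley_stdAddChar_mul_stdAddChar a b (rr n), hψs, hψΛ]
      ring
    rw [hT_eq, norm_mul, norm_inv, Complex.norm_natCast]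
    have hsum : ‖∑ a : ZMod s, Gh a *
        ∑ n ∈ Finset.range K, (𝐞 (((rr n : ℤ) : ℝ) * ((a.val : ℝ) / s + (b.val : ℝ) / Λ)) : ℂ)‖ ≤
        B * (2 * (2 * s) + s * (1 + Real.log s)) := by
      calc ‖∑ a : ZMod s, Gh a *
            ∑ n ∈ Finset.range K, (𝐞 (((rr n : ℤ) : ℝ) * ((a.val : ℝ) / s + (b.val : ℝ) / Λ)) : ℂ)‖
          ≤ ∑ a : ZMod s, ‖Gh a *
            ∑ n ∈ Finset.range K, (𝐞 (((rr n : ℤ) : ℝ) * ((a.val : ℝ) / s + (b.val : ℝ) / Λ)) : ℂ)‖ :=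
            norm_sum_le _ _
        _ ≤ ∑ a : ZMod s, B * geomBound (2 * s) ((a.val : ℝ) / s + (b.val : ℝ) / Λ) := by
            refine Finset.sum_le_sum fun a _ => ?_
            rw [norm_mul]
            refine mul_le_mul (hGh_le a) ?_ (norm_nonneg _) hB0
            have := hooley_norm_sum_range_fourierChar_le r₁ ((a.val : ℝ) / s + (b.val : ℝ) / Λ) hKV
            simpa only [hrr] using this
        _ = B * ∑ a ∈ Finset.range s, geomBound (2 * s) ((a : ℝ) / s + (b.val : ℝ) / Λ) := by
            rw [← Finset.mul_sum, Literature.NumberTheory.LFunctions.sum_zmod_eq_sum_range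
              (fun a : ZMod s => geomBound (2 * s) ((a.val : ℝ) / s + (b.val : ℝ) / Λ))]
            congr 1
            refine Finset.sum_congr rfl fun a ha => ?_
            rw [Finset.mem_range] at ha
            rw [ZMod.val_natCast, Nat.mod_eq_of_lt ha]
        _ ≤ B * (2 * (2 * s) + s * (1 + Real.log s)) :=
            mul_le_mul_of_nonneg_left (hooley_sum_geomBound_le hs0 _ (by positivity)) hB0
    calc (s : ℝ)⁻¹ * ‖∑ a : ZMod s, Gh a *
          ∑ n ∈ Finset.range K, (𝐞 (((rr n : ℤ) : ℝ) * ((a.val : ℝ) / s + (b.val : ℝ) / Λ)) : ℂ)‖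
        ≤ (s : ℝ)⁻¹ * (B * (2 * (2 * s) + s * (1 + Real.log s))) :=
          mul_le_mul_of_nonneg_left hsum (by positivity)
      _ = B * (5 + Real.log s) := by field_simp; ring
  -- Step 4: assemble
  rw [hS_eq, norm_mul, norm_inv, Complex.norm_natCast]
  have hΛ0' : (0 : ℝ) < Λ := by exact_mod_cast (show 0 < Λ by omega)
  have hsumb : ‖∑ b : ZMod Λ, (ψΛ (-(b * (lam : ZMod Λ))) : ℂ) * T b‖ ≤ Λ * (B * (5 + Real.log s)) := by
    calc ‖∑ b : ZMod Λ, (ψΛ (-(b * (lam : ZMod Λ))) : ℂ) * T b‖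
        ≤ ∑ b : ZMod Λ, ‖(ψΛ (-(b * (lam : ZMod Λ))) : ℂ) * T b‖ := norm_sum_le _ _
      _ ≤ ∑ b : ZMod Λ, B * (5 + Real.log s) := by
          refine Finset.sum_le_sum fun b _ => ?_
          rw [norm_mul, hψΛ, ZMod.stdAddChar_apply, Circle.norm_coe, one_mul]
          exact hT_le b
      _ = Λ * (B * (5 + Real.log s)) := by
          rw [Finset.sum_const, Finset.card_univ, ZMod.card, nsmul_eq_mul]
  have hlog5 : 0 ≤ 5 + Real.log s := by
    have := Real.log_nonneg hs1'; linarith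
  calc (Λ : ℝ)⁻¹ * ‖∑ b : ZMod Λ, (ψΛ (-(b * (lam : ZMod Λ))) : ℂ) * T b‖
      ≤ (Λ : ℝ)⁻¹ * (Λ * (B * (5 + Real.log s))) :=
        mul_le_mul_of_nonneg_left hsumb (by positivity)
    _ = B * (5 + Real.log s) := by field_simp
    _ = (Nat.divisors s).card * (5 + Real.log s) * Real.sqrt s * Real.sqrt (Int.gcd h s) := by
        rw [hB]; ring
    _ ≤ (Cτ * (s : ℝ) ^ (ε / 2)) * ((5 + 2 / ε) * (s : ℝ) ^ (ε / 2)) * Real.sqrt s *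
          Real.sqrt (Int.gcd h s) := by
        have h1 : ((Nat.divisors s).card : ℝ) ≤ Cτ * (s : ℝ) ^ (ε / 2) := hCτ s (by omega)
        have h2 : 5 + Real.log s ≤ (5 + 2 / ε) * (s : ℝ) ^ (ε / 2) := hooley_log_le hε hs1'
        have h12 : ((Nat.divisors s).card : ℝ) * (5 + Real.log s) ≤
            (Cτ * (s : ℝ) ^ (ε / 2)) * ((5 + 2 / ε) * (s : ℝ) ^ (ε / 2)) :=
          mul_le_mul h1 h2 hlog5 (by positivity)
        gcongr
    _ = Cτ * (5 + 2 / ε) * (s : ℝ) ^ (1 / 2 + ε) * Real.sqrt (Int.gcd h s) := by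
        rw [Real.sqrt_eq_rpow, show (1 / 2 + ε : ℝ) = ε / 2 + ε / 2 + 1 / 2 by ring,
          Real.rpow_add hs0', Real.rpow_add hs0']
        ring

/-- **Lemma 6 from Weil's bound at PRIME moduli only — PROVED** (composition of
`lemma6_hooley_of_weil` with the proved reduction
`Literature.NumberTheory.LFunctions.weil_kloosterman_bound_of_prime` of (2.25) to the prime case,
`KloostermanWeilFromPrime.lean`): the only unproved input left under Iwaniec's Lemma 6 is
`|S(a, b; p)| ≤ 2√p` for `p` prime, `p ∤ ab` (A. Weil 1948). [cite: IwaniecInventiones1978, Lemma 6] -/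
theorem lemma6_hooley_of_weil_prime
    (hW : Literature.NumberTheory.LFunctions.weil_kloosterman_bound_prime) : lemma6_hooley :=
  lemma6_hooley_of_weil (Literature.NumberTheory.LFunctions.weil_kloosterman_bound_of_prime hW)

end Literature.NumberTheory.Sieve.Iwaniec1978

end
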